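import Summits.QuantumFields.BalabanUV.Beta.FP.LatticeKernelSliceMoments
import Summits.QuantumFields.BalabanUV.Beta.FP.PerfectSymbolKMultiplierClosed
import Summits.QuantumFields.BalabanUV.Beta.FP.PerfectSymbol166StripReg

/-!
# `BalabanUV.Beta.FP.PerfectHessianColumnMoments` — road «FP» for binder row D1, leaf (H2), row H2V-4 (N) part 2∕2 (the PERFECT data in the cubic-germ
# uniqueness theorem): THE COLUMN MOMENTS OF BAŁABAN's PERFECT EFFECTIVE LAPLACIAN `Δ_∞` THROUGH ORDER TWO — zeroth and first moments VANISH, the pure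
# second moment is the CANONICAL MAXWELL one, `Σ'_x Δ_∞((x,α),(0,β))·x_κ² = −2·δ_{αβ}·[α ≠ κ]`; hence the Ward-normalised cubic-germ coefficient of
# `AdmissibleCubicGerm` at the perfect Hessian is `cQ(c, Δ_∞) = c` — NO TREE-LEVEL RENORMALISATION OF THE MAXWELL TERM AT THE FIXED POINT

HONEST DEPENDENCY (page 1, mandatory): continuum YM on T⁴ ⇐ BetaPertH ∧ nine spine estimates (0/9 proved); BetaPertH ⇐ (D1) ∧ (D4) ∧ CAP+tail;
G-an2-4 gates asym, D1 and NE2/3/4.  HONEST FRAMING (cell contract, verbatim): «discharging `BetaPertH` makes Bałaban's UV stability UNCONDITIONAL —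
a real constructive-QFT result; it is NOT the continuum limit and NOT the Clay problem.»  THIS MODULE DISCHARGES NOTHING of the wall: it is [our object]
bookkeeping on the EXPLICIT closed-form perfect symbol (`PerfectSymbolKMultiplierClosed.GsymInf = ½·W_∞·(e^{−ip_a}−1)(e^{ip_b}−1)`, `deltaZLim_eq_closed`,
`PerfectSymbol166.W166Inf_zero`, `PerfectSymbol166StripReg.stripRegular_W166Inf`) over part 1's [folklore] slice-moment dictionary
(`LatticeKernelSliceMoments`).  No `def`, no `def … : Prop`, nothing cited as a hypothesis, 0 sorry; 0∕4 row-D1 binders; NOT `hgerm` for the perfect JETS, NOT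
row H2V-4 as a whole, NOT D1, NOT BetaPertH, NOT continuum, NOT Clay.  «not in print; our bookkeeping».

ABSOLUTE RULE (cell charter, verbatim): «No internally-minted statement may enter as a cited fact. Every hypothesis is either kernel-proved in this package or a
verbatim quotation of a PUBLISHED theorem with page reference. The manuscript(s) under audit are NOT citable for their own disputed steps — they are the thing
under adjudication; programme-internal (2001/route/tribunal) claims are never citable.»

WHY (owner's technique of record — invariant theory ∕ polarization, `H2V-DESIGN.md` §0 §2; `AdmissibleCubicGerm.cubicGermOf_eq_smul_ymGerm_of_admissible`,
row H2V-1 ✓): the admissible letters fix the cubic germ of ANY vertex family to `cQ·ymGerm` with `cQ := c·(−½ Σ'_x M x 0 (inl 0) (inl 0)·x₁²)`, `c` the Ward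
constant and `M` the Hessian block of the divergence law (a4), and ask of `M`'s column through `0` vanishing zeroth and first moments (letters (a5)).  For the
PERFECT data `M := Δ_∞` (`EffectiveLaplacianLimit.deltaZLim`, H2-P-DICT ✓) this file PROVES those two letters and EVALUATES the one number:
`−½ Σ'_x Δ_∞((x,0),(0,0))·x₁² = 1`, i.e. `cQ(c, Δ_∞) = c` — the quadratic germ of the perfect Hessian is EXACTLY the canonical Maxwell germ with coefficient
`W_∞(0) = 1` (`W166Inf_zero`); no derivative of `W_∞` enters because the form factor `(e^{−ip_a}−1)(e^{ip_b}−1)` vanishes to second order at `p = 0`.  This is the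
kernel-side reading of «g_n ≡ g in d = 4» (Erice (3.30)) ∕ B5 (1.66) at `p = 0` (cf. `DIVERGENCE.md` D-d1p3-g9-1b).  WHAT STAYS OPEN of row H2V-4 after this file:
the S-side letters of the perfect cubic JET ((a1)(a2)(a4)(a6); input X1-S♭), the column's permutation ∕ bond-reflection covariance at kernel level
(symbol side `PerfectSymbolPerm.W166Inf_psite` ∕ `W166Inf_cflip` ✓, `PerfectPropagatorReflection.latticeKernel_cflip` ✓), and the `Decays` letter (=
`EffectiveLaplacianLimit.decays_toMKer_deltaZLim` ✓ re-packaged on `Fib 3`).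

WHAT.  §2 [our object] the entry symbol on the `i`-slice through `0`: `GsymInf_slice_of_ne` (vanishes unless `a = b = i`), `GsymInf_slice_self`
(`= ½·W̃(z)·(2 − e^{iz} − e^{−iz})`), `stripRegular_GsymInf`, `deriv_GsymInf_slice` (`(slice)′(0) = 0`, `(slice)″(0) = [a = i ∧ b = i]`), **`hasSum_kerInf`** ∕
`hasSum_re_kerInf` (entry-kernel moments `0, 0, −[a = i ∧ b = i]`).  §3 [our object] the column of `Δ_∞` through `(0,β)`: `hasSum_deltaZLim_col_weight` (linearity),
**`hasSum_deltaZLim_col`** (`= 0`), **`hasSum_deltaZLim_col_mul_coord`** (`= 0`), **`hasSum_deltaZLim_col_mul_coord_sq`** (`= −2·δ_{αβ}·[α ≠ κ]`, every `d`), and at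
`d + 1 = 4`: **`half_colMoment_deltaZLim`** (`= 1`) and the SOCKET **`admissible_column_letters_deltaZLim`** (for ANY `M : MKer 4 (Fib 3)` whose field–field column
through `0` is `Δ_∞`'s: `AdmissibleCubicGerm`'s `hM0`, `hM1` hold and `c·(−½Σ'_x M x 0 (inl 0)(inl 0)·x₁·x₁) = c`).
Provenance: road FP OWNER b2b-balaban-beta-d1-p3 gen 9 (prover-b2b-balaban-beta-d1-p3-g9-0), 2026-08-21, row H2V-4 (N) «perfect Ward normalisation».
-/

noncomputable section

namespace Summit.QuantumFields.BalabanUV.Beta.FP.PerfectHessianColumnMoments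

open Finset Complex Set MeasureTheory Filter Topology
open scoped BigOperators Real
open Literature.MathematicalPhysics.QuantumFieldTheory.Balaban1983to89
open B4Strip (Strip ofRealVec)
open B4ContourShift (BZ phase integrand fourierBox latticeKernel StripRegular supNorm latticeKernel_decay ofRealVec_insertNth
  abs_le_supNorm supNorm_nonneg openRect ofRealVec_mem_Strip stripRegular_const)
open B12Sec2to5 (l1 l1_nonneg)
open B5Symbol166Strip (expFacNeg expFacPos kappa166 kappa166_pos MW MW_pos stripRegular_expFacNeg stripRegular_expFacPos)
open B4Sect5Exhaustion (K)
open Beta.ExpKernelCalculus (MKer)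
open Beta.OneStepResolventKernel (Fib)
open Summit.QuantumFields.BalabanUV.Beta.GAN24.DirichletExhaustionDeltaZ (summand dirI)
open Summit.QuantumFields.BalabanUV.Beta.GAN24.EffectiveLaplacianLimit (deltaZLim)
open Summit.QuantumFields.BalabanUV.Beta.FP.PerfectSymbol166 (W166Inf W166Inf_zero)
open Summit.QuantumFields.BalabanUV.Beta.FP.PerfectSymbol166StripReg (stripRegular_W166Inf)
open Summit.QuantumFields.BalabanUV.Beta.FP.PerfectSymbolKMultiplierClosed (GsymInf deltaZLim_eq_closed)
open Summit.QuantumFields.BalabanUV.Beta.FP.LatticeKernelSliceMoments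

variable {d : ℕ}

/-! ## §2 The perfect entry symbol on a slice through the origin -/

section Entry

/-- [folklore] coordinates of the slice point: `(i.insertNth z 0) a = [a = i]·z`. -/
theorem insertNth_ofRealVec_zero_apply (i : Fin (d + 1)) (z : ℂ) (a : Fin (d + 1)) :
    (i.insertNth z (ofRealVec (0 : Fin d → ℝ)) : Fin (d + 1) → ℂ) a = if a = i then z else 0 := by
  refine Fin.succAboveCases i ?_ ?_ a
  · simp [Fin.insertNth_apply_same]
  · intro k; simp [Fin.insertNth_apply_succAbove, ofRealVec, Fin.succAbove_ne i k]

/-- [our object] off the slice direction `e^{−ip_a} − 1` VANISHES on the slice. -/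
theorem expFacNeg_slice_of_ne {i a : Fin (d + 1)} (h : a ≠ i) (z : ℂ) : expFacNeg a (i.insertNth z (ofRealVec (0 : Fin d → ℝ))) = 0 := by
  unfold expFacNeg; rw [insertNth_ofRealVec_zero_apply, if_neg h]; simp

/-- [our object] off the slice direction the form factor `e^{ip_b} − 1` VANISHES on the slice. -/
theorem expFacPos_slice_of_ne {i b : Fin (d + 1)} (h : b ≠ i) (z : ℂ) : expFacPos b (i.insertNth z (ofRealVec (0 : Fin d → ℝ))) = 0 := by
  unfold expFacPos; rw [insertNth_ofRealVec_zero_apply, if_neg h]; simp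

/-- [our object] in the slice direction: `e^{−ip_i} − 1 = e^{−iz} − 1`. -/
theorem expFacNeg_slice_self (i : Fin (d + 1)) (z : ℂ) : expFacNeg i (i.insertNth z (ofRealVec (0 : Fin d → ℝ))) = cexp (-(z * I)) - 1 := by
  unfold expFacNeg; rw [insertNth_ofRealVec_zero_apply, if_pos rfl]

/-- [our object] in the slice direction: `e^{ip_i} − 1 = e^{iz} − 1`. -/
theorem expFacPos_slice_self (i : Fin (d + 1)) (z : ℂ) : expFacPos i (i.insertNth z (ofRealVec (0 : Fin d → ℝ))) = cexp (z * I) - 1 := by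
  unfold expFacPos; rw [insertNth_ofRealVec_zero_apply, if_pos rfl]

/-- [folklore] `(e^{−iz} − 1)(e^{iz} − 1) = 2 − e^{iz} − e^{−iz}`. -/
theorem expFac_prod_eq (z : ℂ) : (cexp (-(z * I)) - 1) * (cexp (z * I) - 1) = 2 - cexp (z * I) - cexp (-(z * I)) := by
  have h : cexp (-(z * I)) * cexp (z * I) = 1 := by rw [← Complex.exp_add, neg_add_cancel, Complex.exp_zero]
  linear_combination h

/-- [our object] **THE ENTRY SYMBOL VANISHES IDENTICALLY ON THE `i`-SLICE THROUGH `0` UNLESS BOTH BOND DIRECTIONS ARE `i`.** -/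
theorem GsymInf_slice_of_ne {μ ν a b i : Fin (d + 1)} (h : a ≠ i ∨ b ≠ i) (z : ℂ) :
    GsymInf μ ν a b (i.insertNth z (ofRealVec (0 : Fin d → ℝ))) = 0 := by
  unfold GsymInf
  rcases h with h | h
  · rw [expFacNeg_slice_of_ne h]; simp
  · rw [expFacPos_slice_of_ne h]; simp

/-- [our object] **ON THE `i`-SLICE WITH BOTH BOND DIRECTIONS `i`**: `G_∞(μν;ii)(z e_i) = ½·W̃(z)·(2 − e^{iz} − e^{−iz})`, `W̃(z) := W_∞(μ,ν; z e_i)`. -/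
theorem GsymInf_slice_self (μ ν i : Fin (d + 1)) (z : ℂ) :
    GsymInf μ ν i i (i.insertNth z (ofRealVec (0 : Fin d → ℝ))) =
      1 / 2 * W166Inf μ ν (i.insertNth z (ofRealVec (0 : Fin d → ℝ))) * (2 - cexp (z * I) - cexp (-(z * I))) := by
  unfold GsymInf
  rw [expFacNeg_slice_self, expFacPos_slice_self, expFac_prod_eq]

/-- [our object] the entry symbol vanishes at the origin. -/
theorem GsymInf_zero (μ ν a b : Fin (d + 1)) : GsymInf μ ν a b (0 : Fin (d + 1) → ℂ) = 0 := by
  unfold GsymInf expFacPos; simp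

/-- [our object] **STRIP REGULARITY OF THE CLOSED-FORM ENTRY SYMBOL** `G_∞(μν;ab)` (`μ ≠ ν`, `0 ≤ κ ≤ κ₁₆₆(d+1)`; twin of `stripRegular_Gsym`). -/
theorem stripRegular_GsymInf {κ : ℝ} (hκ0 : 0 ≤ κ) (hκ : κ ≤ kappa166 (d + 1)) {μ ν : Fin (d + 1)} (hμν : μ ≠ ν) (a b : Fin (d + 1)) :
    StripRegular (d := d) (GsymInf μ ν a b) κ (1 / 2 * MW (d + 1) * ((Real.exp κ + 1) * (Real.exp κ + 1))) := by
  have hW := stripRegular_W166Inf (d := d) hκ0 hκ hμν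
  have hc : StripRegular (d := d) (fun _ : Fin (d + 1) → ℂ => (1 / 2 : ℂ)) κ (1 / 2) := by
    have := stripRegular_const (d := d) (1 / 2 : ℂ) κ
    refine this.mono (le_of_eq ?_)
    rw [norm_div, norm_one, Complex.norm_two]
  have hE := (stripRegular_expFacNeg (d := d) a κ).mul (stripRegular_expFacPos (d := d) b κ) (by positivity)
  exact ((hc.mul hW (by norm_num)).mul hE (by have := MW_pos (d + 1); positivity))

/-- [folklore] the derivatives of `e^{iz}` and `e^{−iz}`. -/
theorem hasDerivAt_cexp_pair (z : ℂ) :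
    HasDerivAt (fun z : ℂ => cexp (z * I)) (cexp (z * I) * I) z ∧ HasDerivAt (fun z : ℂ => cexp (-(z * I))) (cexp (-(z * I)) * (-I)) z := by
  refine ⟨by simpa using ((hasDerivAt_id z).mul_const I).cexp, ?_⟩
  have h0 : HasDerivAt (fun z : ℂ => -(z * I)) (-I) z := by
    have := (hasDerivAt_id z).mul_const (-I)
    have hfun : (fun z : ℂ => -(z * I)) = fun z : ℂ => id z * (-I) := by funext w; simp
    rw [hfun]; exact this.congr_deriv (by simp)
  simpa using h0.cexp

/-- [folklore] `E(z) = 2 − e^{iz} − e^{−iz}` has derivative `E′(z) = i e^{−iz} − i e^{iz}`. -/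
theorem hasDerivAt_trigE (z : ℂ) :
    HasDerivAt (fun z : ℂ => 2 - cexp (z * I) - cexp (-(z * I))) (I * cexp (-(z * I)) - I * cexp (z * I)) z := by
  obtain ⟨h1, h2⟩ := hasDerivAt_cexp_pair z
  exact (((hasDerivAt_const z (2 : ℂ)).sub h1).sub h2).congr_deriv (by ring)

/-- [folklore] `E′(z) = i e^{−iz} − i e^{iz}` has derivative `E″(z) = e^{iz} + e^{−iz}`. -/
theorem hasDerivAt_trigE' (z : ℂ) :
    HasDerivAt (fun z : ℂ => I * cexp (-(z * I)) - I * cexp (z * I)) (cexp (z * I) + cexp (-(z * I))) z := by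
  obtain ⟨h1, h2⟩ := hasDerivAt_cexp_pair z
  refine ((h2.const_mul I).sub (h1.const_mul I)).congr_deriv ?_
  have hI : I * I = -1 := Complex.I_mul_I
  linear_combination (-(cexp (z * I)) - cexp (-(z * I))) * hI

/-- [our object] **THE SLICE OF `W_∞` THROUGH THE ORIGIN IS HOLOMORPHIC AT `0`** (`μ ≠ ν`), with value `1` there. -/
theorem analyticAt_W166Inf_slice {μ ν : Fin (d + 1)} (hμν : μ ≠ ν) (i : Fin (d + 1)) :
    AnalyticAt ℂ (fun z : ℂ => W166Inf μ ν (i.insertNth z (ofRealVec (0 : Fin d → ℝ)))) 0 ∧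
      W166Inf μ ν (i.insertNth (0 : ℂ) (ofRealVec (0 : Fin d → ℝ))) = 1 := by
  have hκ := kappa166_pos (d + 1)
  have h := analyticAt_slice (stripRegular_W166Inf (d := d) hκ.le le_rfl hμν) hκ i (t := 0) (by simp [Real.pi_pos])
  rw [Complex.ofReal_zero] at h
  exact ⟨h, by rw [insertNth_zero_ofRealVec_zero, W166Inf_zero]⟩

/-- [our object] off the diagonal bond pair the whole slice is the zero function. -/
theorem GsymInf_slice_fun_of_ne {μ ν a b i : Fin (d + 1)} (h : a ≠ i ∨ b ≠ i) :
    (fun z : ℂ => GsymInf μ ν a b (i.insertNth z (ofRealVec (0 : Fin d → ℝ)))) = fun _ => 0 :=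
  funext fun z => GsymInf_slice_of_ne h z

/-- [our object] **THE DERIVATIVE OF THE DIAGONAL ENTRY SLICE NEAR `0`** (product rule against `E`): at every point where the `W_∞`-slice is differentiable. -/
theorem hasDerivAt_GsymInf_slice_self {μ ν : Fin (d + 1)} (i : Fin (d + 1)) {z : ℂ}
    (hz : DifferentiableAt ℂ (fun z : ℂ => W166Inf μ ν (i.insertNth z (ofRealVec (0 : Fin d → ℝ)))) z) :
    HasDerivAt (fun z : ℂ => GsymInf μ ν i i (i.insertNth z (ofRealVec (0 : Fin d → ℝ))))
      (1 / 2 * deriv (fun z : ℂ => W166Inf μ ν (i.insertNth z (ofRealVec (0 : Fin d → ℝ)))) z * (2 - cexp (z * I) - cexp (-(z * I))) +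
        1 / 2 * W166Inf μ ν (i.insertNth z (ofRealVec (0 : Fin d → ℝ))) * (I * cexp (-(z * I)) - I * cexp (z * I))) z := by
  have h := (hz.hasDerivAt.const_mul (1 / 2 : ℂ)).mul (hasDerivAt_trigE z)
  refine h.congr_of_eventuallyEq (Filter.Eventually.of_forall fun w => ?_)
  simpa only [Pi.mul_apply] using GsymInf_slice_self μ ν i w

/-- [our object] **FIRST DERIVATIVE OF THE DIAGONAL ENTRY SLICE AT `0` VANISHES** (`E(0) = E′(0) = 0`). -/
theorem deriv_GsymInf_slice_self {μ ν : Fin (d + 1)} (hμν : μ ≠ ν) (i : Fin (d + 1)) :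
    deriv (fun z : ℂ => GsymInf μ ν i i (i.insertNth z (ofRealVec (0 : Fin d → ℝ)))) 0 = 0 := by
  obtain ⟨hWa, -⟩ := analyticAt_W166Inf_slice (d := d) hμν i
  rw [(hasDerivAt_GsymInf_slice_self i hWa.differentiableAt).deriv]
  norm_num

/-- [our object] **SECOND DERIVATIVE OF THE DIAGONAL ENTRY SLICE AT `0` IS `1`** — from `W_∞(0) = 1` only (`E(0) = E′(0) = 0`, `E″(0) = 2`). -/
theorem deriv_deriv_GsymInf_slice_self {μ ν : Fin (d + 1)} (hμν : μ ≠ ν) (i : Fin (d + 1)) :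
    deriv (deriv (fun z : ℂ => GsymInf μ ν i i (i.insertNth z (ofRealVec (0 : Fin d → ℝ))))) 0 = 1 := by
  obtain ⟨hWa, hW0⟩ := analyticAt_W166Inf_slice (d := d) hμν i
  have hderiv : deriv (fun z : ℂ => GsymInf μ ν i i (i.insertNth z (ofRealVec (0 : Fin d → ℝ)))) =ᶠ[𝓝 (0 : ℂ)]
      fun z => 1 / 2 * deriv (fun z : ℂ => W166Inf μ ν (i.insertNth z (ofRealVec (0 : Fin d → ℝ)))) z * (2 - cexp (z * I) - cexp (-(z * I))) +
        1 / 2 * (fun z : ℂ => W166Inf μ ν (i.insertNth z (ofRealVec (0 : Fin d → ℝ)))) z * (I * cexp (-(z * I)) - I * cexp (z * I)) := by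
    filter_upwards [hWa.eventually_analyticAt] with z hz
    exact (hasDerivAt_GsymInf_slice_self i hz.differentiableAt).deriv
  rw [hderiv.deriv_eq]
  have hW1 := hWa.differentiableAt.hasDerivAt
  have hW2 := hWa.deriv.differentiableAt.hasDerivAt
  have hg := ((hW2.const_mul (1 / 2 : ℂ)).mul (hasDerivAt_trigE 0)).add ((hW1.const_mul (1 / 2 : ℂ)).mul (hasDerivAt_trigE' 0))
  have hg' : HasDerivAt (fun z => 1 / 2 * deriv (fun z : ℂ => W166Inf μ ν (i.insertNth z (ofRealVec (0 : Fin d → ℝ)))) z * (2 - cexp (z * I) - cexp (-(z * I))) +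
        1 / 2 * (fun z : ℂ => W166Inf μ ν (i.insertNth z (ofRealVec (0 : Fin d → ℝ)))) z * (I * cexp (-(z * I)) - I * cexp (z * I)))
      (1 / 2 * deriv (deriv (fun z : ℂ => W166Inf μ ν (i.insertNth z (ofRealVec (0 : Fin d → ℝ))))) 0 * (2 - cexp (0 * I) - cexp (-(0 * I))) + 1 / 2 * deriv (fun z : ℂ => W166Inf μ ν (i.insertNth z (ofRealVec (0 : Fin d → ℝ)))) 0 * (I * cexp (-(0 * I)) - I * cexp (0 * I)) +
        (1 / 2 * deriv (fun z : ℂ => W166Inf μ ν (i.insertNth z (ofRealVec (0 : Fin d → ℝ)))) 0 * (I * cexp (-(0 * I)) - I * cexp (0 * I)) + 1 / 2 * (fun z : ℂ => W166Inf μ ν (i.insertNth z (ofRealVec (0 : Fin d → ℝ)))) 0 * (cexp (0 * I) + cexp (-(0 * I))))) 0 := by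
    refine hg.congr_of_eventuallyEq (Filter.Eventually.of_forall fun w => ?_)
    simp only [Pi.add_apply, Pi.mul_apply]
  rw [hg'.deriv]
  have hW00 : (fun z : ℂ => W166Inf μ ν (i.insertNth z (ofRealVec (0 : Fin d → ℝ)))) 0 = 1 := hW0
  rw [hW00]
  norm_num

/-- [our object] **THE FIRST TWO SLICE DERIVATIVES OF THE ENTRY SYMBOL AT `0`**, all cases: `(slice)′(0) = 0`, `(slice)″(0) = [a = i ∧ b = i]`. -/
theorem deriv_GsymInf_slice {μ ν : Fin (d + 1)} (hμν : μ ≠ ν) (a b i : Fin (d + 1)) :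
    deriv (fun z : ℂ => GsymInf μ ν a b (i.insertNth z (ofRealVec (0 : Fin d → ℝ)))) 0 = 0 ∧
      deriv (deriv (fun z : ℂ => GsymInf μ ν a b (i.insertNth z (ofRealVec (0 : Fin d → ℝ))))) 0 = if a = i ∧ b = i then 1 else 0 := by
  by_cases h : a = i ∧ b = i
  · rw [if_pos h]
    obtain ⟨ha, hb⟩ := h
    subst ha; subst hb
    exact ⟨deriv_GsymInf_slice_self hμν _, deriv_deriv_GsymInf_slice_self hμν _⟩
  · rw [if_neg h]
    have h' : a ≠ i ∨ b ≠ i := by tauto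
    rw [GsymInf_slice_fun_of_ne h', deriv_const']
    simp

/-- [our object] **THE THREE MOMENTS OF THE PERFECT ENTRY KERNEL** `K_∞(μν;ab)` (`μ ≠ ν`): `0`, `0` (coordinate `i`), `−[a = i ∧ b = i]` (pure second). -/
theorem hasSum_kerInf {μ ν : Fin (d + 1)} (hμν : μ ≠ ν) (a b i : Fin (d + 1)) :
    HasSum (fun x : Fin (d + 1) → ℤ => latticeKernel (GsymInf μ ν a b) x) 0 ∧
      HasSum (fun x : Fin (d + 1) → ℤ => latticeKernel (GsymInf μ ν a b) x * (x i : ℂ)) 0 ∧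
        HasSum (fun x : Fin (d + 1) → ℤ => latticeKernel (GsymInf μ ν a b) x * (x i : ℂ) ^ 2) (-(if a = i ∧ b = i then 1 else 0)) := by
  have hκ := kappa166_pos (d + 1)
  have hA := stripRegular_GsymInf (d := d) hκ.le le_rfl hμν a b
  obtain ⟨hd1, hd2⟩ := deriv_GsymInf_slice (d := d) hμν a b i
  refine ⟨?_, ?_, ?_⟩
  · have h := hasSum_latticeKernel_zero hA hκ
    rwa [GsymInf_zero] at h
  · have h := hasSum_latticeKernel_mul_coord hA hκ i
    rwa [hd1, mul_zero] at h
  · have h := hasSum_latticeKernel_mul_coord_sq hA hκ i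
    rwa [hd2] at h

/-- [our object] real parts, real weights: the moments of `Re K_∞(μν;ab)` against `1`, `x_i`, `x_i·x_i`. -/
theorem hasSum_re_kerInf {μ ν : Fin (d + 1)} (hμν : μ ≠ ν) (a b i : Fin (d + 1)) :
    HasSum (fun x : Fin (d + 1) → ℤ => (latticeKernel (GsymInf μ ν a b) x).re) 0 ∧
      HasSum (fun x : Fin (d + 1) → ℤ => (latticeKernel (GsymInf μ ν a b) x).re * (x i : ℝ)) 0 ∧
        HasSum (fun x : Fin (d + 1) → ℤ => (latticeKernel (GsymInf μ ν a b) x).re * ((x i : ℝ) * (x i : ℝ)))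
          (-(if a = i ∧ b = i then 1 else 0)) := by
  obtain ⟨h0, h1, h2⟩ := hasSum_kerInf (d := d) hμν a b i
  refine ⟨?_, ?_, ?_⟩
  · simpa using h0.mapL Complex.reCLM
  · have h := h1.mapL Complex.reCLM
    simp only [Complex.reCLM_apply] at h
    convert h using 1
    · funext x
      rw [show ((x i : ℤ) : ℂ) = (((x i : ℤ) : ℝ) : ℂ) by norm_cast, Complex.re_mul_ofReal]
    · simp
  · have h := h2.mapL Complex.reCLM
    simp only [Complex.reCLM_apply] at h
    convert h using 1
    · funext x
      rw [show ((x i : ℤ) : ℂ) ^ 2 = ((((x i : ℤ) : ℝ) * ((x i : ℤ) : ℝ) : ℝ) : ℂ) by push_cast; ring, Complex.re_mul_ofReal]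
    · split_ifs <;> simp

end Entry

/-! ## §3 The column of `Δ_∞` through `0`: zeroth, first and pure second moments -/

section Column

/-- [our object] the column of `Δ_∞` through the bond `(0,β)` in closed form (`deltaZLim_eq_closed` at `q = (0,β)`). -/
theorem deltaZLim_col_eq (x : Fin (d + 1) → ℤ) (α β : Fin (d + 1)) :
    deltaZLim (d := d) (x, α) (0, β) = ∑ μ : Fin (d + 1), ∑ ν : Fin (d + 1),
      if μ = ν then 0 else summand (fun a b y => (latticeKernel (GsymInf μ ν a b) y).re) μ ν α β x := by
  rw [deltaZLim_eq_closed]; simp only [sub_zero]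

/-- [our object] **LINEARITY OF THE COLUMN MOMENTS IN THE ENTRY MOMENTS** (weight `w`, entry moments `Mw μ ν a b`, `μ ≠ ν`). -/
theorem hasSum_deltaZLim_col_weight (w : (Fin (d + 1) → ℤ) → ℝ) (Mw : Fin (d + 1) → Fin (d + 1) → Fin (d + 1) → Fin (d + 1) → ℝ)
    (h : ∀ μ ν : Fin (d + 1), μ ≠ ν → ∀ a b, HasSum (fun x : Fin (d + 1) → ℤ => (latticeKernel (GsymInf μ ν a b) x).re * w x) (Mw μ ν a b))
    (α β : Fin (d + 1)) :
    HasSum (fun x : Fin (d + 1) → ℤ => deltaZLim (d := d) (x, α) (0, β) * w x)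
      (∑ μ : Fin (d + 1), ∑ ν : Fin (d + 1), if μ = ν then 0 else summand (fun a b _ => Mw μ ν a b) μ ν α β 0) := by
  have hterm : ∀ μ ν : Fin (d + 1), HasSum (fun x : Fin (d + 1) → ℤ =>
      (if μ = ν then 0 else summand (fun a b y => (latticeKernel (GsymInf μ ν a b) y).re) μ ν α β x) * w x)
      (if μ = ν then 0 else summand (fun a b _ => Mw μ ν a b) μ ν α β 0) := by
    intro μ ν
    by_cases hμν : μ = ν
    · simp only [hμν, if_true, zero_mul]; exact hasSum_zero
    · simp only [if_neg hμν]
      have H := fun a b => h μ ν hμν a b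
      have hs := ((((H μ μ).mul_left (dirI ν α * dirI ν β)).sub ((H μ ν).mul_left (dirI ν α * dirI μ β))).sub
        ((H ν μ).mul_left (dirI μ α * dirI ν β))).add ((H ν ν).mul_left (dirI μ α * dirI μ β))
      unfold summand
      exact hs.congr_fun fun x => by ring
  have hsum := hasSum_sum fun μ (_ : μ ∈ (Finset.univ : Finset (Fin (d + 1)))) =>
    hasSum_sum fun ν (_ : ν ∈ (Finset.univ : Finset (Fin (d + 1)))) => hterm μ ν
  refine hsum.congr_fun fun x => ?_
  rw [deltaZLim_col_eq, Finset.sum_mul]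
  refine Finset.sum_congr rfl fun μ _ => ?_
  rw [Finset.sum_mul]

/-- [our object] **ZEROTH COLUMN MOMENT OF `Δ_∞` VANISHES**: `Σ'_x Δ_∞((x,α),(0,β)) = 0` (constant bond fields are annihilated). -/
theorem hasSum_deltaZLim_col (α β : Fin (d + 1)) : HasSum (fun x : Fin (d + 1) → ℤ => deltaZLim (d := d) (x, α) (0, β)) 0 := by
  have h := hasSum_deltaZLim_col_weight (d := d) (fun _ => (1 : ℝ)) (fun _ _ _ _ => 0)
    (fun μ ν hμν a b => by simpa using (hasSum_re_kerInf (d := d) hμν a b a).1) α β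
  simp only [mul_one] at h
  convert h using 1
  simp [summand]

/-- [our object] **FIRST COLUMN MOMENTS OF `Δ_∞` VANISH**: `Σ'_x Δ_∞((x,α),(0,β))·x_κ = 0`. -/
theorem hasSum_deltaZLim_col_mul_coord (α β κ : Fin (d + 1)) :
    HasSum (fun x : Fin (d + 1) → ℤ => deltaZLim (d := d) (x, α) (0, β) * (x κ : ℝ)) 0 := by
  have h := hasSum_deltaZLim_col_weight (d := d) (fun x => (x κ : ℝ)) (fun _ _ _ _ => 0)
    (fun μ ν hμν a b => (hasSum_re_kerInf (d := d) hμν a b κ).2.1) α β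
  convert h using 1
  simp [summand]

/-- [folklore] the finite bond combination of the pure second entry moments: `Σ_{μ≠ν} summand(−[a=κ∧b=κ]) μ ν α β = −2·δ_{αβ}·[α ≠ κ]`. -/
theorem sum_summand_second (α β κ : Fin (d + 1)) :
    (∑ μ : Fin (d + 1), ∑ ν : Fin (d + 1), if μ = ν then (0 : ℝ) else
        summand (fun a b _ => -(if a = κ ∧ b = κ then (1 : ℝ) else 0)) μ ν α β 0) =
      -2 * (if α = β then 1 else 0) * (if α = κ then 0 else 1) := by
  -- per term: for `μ ≠ ν` only the diagonal words `(μ,μ)` and `(ν,ν)` can hit `(κ,κ)`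
  have hterm : ∀ μ ν : Fin (d + 1), (if μ = ν then (0 : ℝ) else summand (fun a b _ => -(if a = κ ∧ b = κ then (1 : ℝ) else 0)) μ ν α β 0) =
      -((if μ = ν then 0 else (if μ = κ then 1 else 0) * (dirI ν α * dirI ν β)) +
        (if μ = ν then 0 else (if ν = κ then 1 else 0) * (dirI μ α * dirI μ β))) := by
    intro μ ν
    by_cases hμν : μ = ν
    · simp [hμν]
    · have hx : ¬(μ = κ ∧ ν = κ) := fun hh => hμν (hh.1.trans hh.2.symm)
      have hx' : ¬(ν = κ ∧ μ = κ) := fun hh => hμν (hh.2.trans hh.1.symm)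
      simp only [if_neg hμν, summand, and_self, hx, hx', if_false, neg_zero, mul_zero, sub_zero]
      split_ifs <;> ring
  rw [Finset.sum_congr rfl fun μ _ => Finset.sum_congr rfl fun ν _ => hterm μ ν]
  simp only [Finset.sum_neg_distrib, Finset.sum_add_distrib]
  -- the two halves are equal by exchanging `μ ↔ ν`
  have hswap : (∑ μ : Fin (d + 1), ∑ ν : Fin (d + 1), if μ = ν then (0 : ℝ) else (if ν = κ then 1 else 0) * (dirI μ α * dirI μ β)) =
      ∑ μ : Fin (d + 1), ∑ ν : Fin (d + 1), if μ = ν then (0 : ℝ) else (if μ = κ then 1 else 0) * (dirI ν α * dirI ν β) := by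
    rw [Finset.sum_comm]
    refine Finset.sum_congr rfl fun μ _ => Finset.sum_congr rfl fun ν _ => ?_
    by_cases h : μ = ν
    · simp [h]
    · rw [if_neg h, if_neg (Ne.symm h)]
  rw [hswap]
  -- evaluate `Σ_μ Σ_ν [μ≠ν][μ=κ]·ι_{να}ι_{νβ} = [κ ≠ α]·ι_{αβ}`
  have hinner : ∀ μ : Fin (d + 1), (∑ ν : Fin (d + 1), if μ = ν then (0 : ℝ) else (if μ = κ then 1 else 0) * (dirI ν α * dirI ν β)) =
      (if μ = κ then 1 else 0) * (if μ = α then 0 else dirI α β) := by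
    intro μ
    have : ∀ ν : Fin (d + 1), (if μ = ν then (0 : ℝ) else (if μ = κ then 1 else 0) * (dirI ν α * dirI ν β)) =
        (if μ = κ then (1 : ℝ) else 0) * (if ν = α then (if μ = α then 0 else dirI α β) else 0) := by
      intro ν
      unfold dirI
      by_cases h1 : μ = ν <;> by_cases h2 : ν = α <;> by_cases h3 : μ = κ <;> by_cases h4 : α = β <;> by_cases h5 : μ = α <;>
        simp [h1, h2, h3, h4, h5] <;> subst_vars <;> simp_all
    rw [Finset.sum_congr rfl fun ν _ => this ν, ← Finset.mul_sum, Finset.sum_ite_eq' Finset.univ α]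
    simp
  rw [Finset.sum_congr rfl fun μ _ => hinner μ]
  simp_rw [boole_mul]
  rw [Finset.sum_ite_eq' Finset.univ κ]
  simp only [Finset.mem_univ, if_true]
  unfold dirI
  by_cases h1 : κ = α <;> by_cases h2 : α = β
  · subst h1; simp [h2]
  · subst h1; simp [h2]
  · have h1' : ¬α = κ := fun h => h1 h.symm
    simp only [if_neg h1, if_pos h2, if_neg h1']; norm_num
  · have h1' : ¬α = κ := fun h => h1 h.symm
    simp only [if_neg h1, if_neg h2, if_neg h1']; norm_num

/-- [our object] **THE PURE SECOND COLUMN MOMENT OF `Δ_∞` IS THE CANONICAL MAXWELL ONE**: `Σ'_x Δ_∞((x,α),(0,β))·x_κ·x_κ = −2·δ_{αβ}·[α ≠ κ]`. -/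
theorem hasSum_deltaZLim_col_mul_coord_sq (α β κ : Fin (d + 1)) :
    HasSum (fun x : Fin (d + 1) → ℤ => deltaZLim (d := d) (x, α) (0, β) * ((x κ : ℝ) * (x κ : ℝ)))
      (-2 * (if α = β then 1 else 0) * (if α = κ then 0 else 1)) := by
  have h := hasSum_deltaZLim_col_weight (d := d) (fun x => (x κ : ℝ) * (x κ : ℝ)) (fun _ _ a b => -(if a = κ ∧ b = κ then (1 : ℝ) else 0))
    (fun μ ν hμν a b => (hasSum_re_kerInf (d := d) hμν a b κ).2.2) α β
  rwa [sum_summand_second] at h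

/-- [our object] **THE NUMBER THE CUBIC-GERM UNIQUENESS THEOREM READS** (`d + 1 = 4`, entry `(0,0)`, coordinate `1`):
`−½·Σ'_x Δ_∞((x,0),(0,0))·x₁·x₁ = 1` — the Ward-normalised germ coefficient at the perfect Hessian is `cQ(c, Δ_∞) = c·1`. -/
theorem half_colMoment_deltaZLim :
    -(1 / 2 : ℝ) * ∑' x : Fin (3 + 1) → ℤ, deltaZLim (d := 3) (x, 0) (0, 0) * ((x 1 : ℝ) * (x 1 : ℝ)) = 1 := by
  rw [(hasSum_deltaZLim_col_mul_coord_sq (d := 3) 0 0 1).tsum_eq]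
  norm_num

/-- [our object] **THE SOCKET FOR `AdmissibleCubicGerm.cubicGermOf_eq_smul_ymGerm_of_admissible` AT THE PERFECT DATA**: for ANY `M : MKer 4 (Fib 3)` whose
field–field column through `0` is `Δ_∞`'s, the (a5) moment letters `hM0`, `hM1` hold and the germ coefficient `c·(−½ Σ'_x M x 0 (inl 0)(inl 0)·x₁·x₁)` is `c`. -/
theorem admissible_column_letters_deltaZLim {M : MKer (3 + 1) (Fib 3)}
    (hM : ∀ (x : Fin (3 + 1) → ℤ) (μ ν : Fin (3 + 1)), M x 0 (Sum.inl μ) (Sum.inl ν) = deltaZLim (d := 3) (x, μ) (0, ν)) (c : ℝ) :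
    (∀ μ ν : Fin (3 + 1), ∑' x : Fin (3 + 1) → ℤ, M x 0 (Sum.inl μ) (Sum.inl ν) = 0) ∧
      (∀ μ ν κ : Fin (3 + 1), ∑' x : Fin (3 + 1) → ℤ, M x 0 (Sum.inl μ) (Sum.inl ν) * (x κ : ℝ) = 0) ∧
        c * (-(1 / 2 : ℝ) * ∑' x : Fin (3 + 1) → ℤ, M x 0 (Sum.inl 0) (Sum.inl 0) * ((x 1 : ℝ) * (x 1 : ℝ))) = c := by
  refine ⟨fun μ ν => ?_, fun μ ν κ => ?_, ?_⟩
  · simp_rw [hM]; exact (hasSum_deltaZLim_col (d := 3) μ ν).tsum_eq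
  · simp_rw [hM]; exact (hasSum_deltaZLim_col_mul_coord (d := 3) μ ν κ).tsum_eq
  · simp_rw [hM]; rw [half_colMoment_deltaZLim, mul_one]

end Column

end Summit.QuantumFields.BalabanUV.Beta.FP.PerfectHessianColumnMoments

end
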